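import Summits.QuantumFields.BalabanUV.T4Continuum.Spine.NE1p.DressedSmallFieldCoresWitness

/-!
# T⁴ programme, spine estimate NE1′ (node O3b/H2) — WITNESS TAIL «THE SOURCE IS IDENTIFIABLE»: THE GAUSSIAN-CORE PENCIL TERM IS
# INJECTIVE (CO-LIPSCHITZ) ON THE COMPLEX SOURCE DISC — COMPLEX-SOURCE LIVENESS FOR THE CORES WITNESSES, PART 1 of 2

Cell `pub-balaban`, sub-cell `t4`, row NE1′ formalisation crew (`t4/formal/NE1p/LEAVES.md` row **W100 ∕ DAG N29zzzzzo**; INTENT `HOME/CLAIMS.log`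
l.24957, STAGED l.25062, BOOKED typer RULING R-T154 l.25118; read X245), unit `b2b-balaban-t4-ne1p-formalise-leaf-09` (gen 15).  ADDITIVE — imports W33 `Spine/NE1p/DressedSmallFieldCoresWitness`
(p225894 ∕ v1.1 p226437, lineage leaf-10; → N0p, W24) ONLY; two toy-DATA `def`s (`pencil`, `pencilM` — W33's `termBi_coreFam` integrand READ AS A FUNCTION OF THE
COMPLEX SOURCE, and its first moment) + theorems; 0 `def … : Prop`, 0 cite, 0 sorry, 0 `attribute`; nothing of W33 ∕ W24 ∕ N0p restated — their
declarations (`E1`, `crd`, `integrable_gauss_E1`, `integrable_term`, `termBi_coreFam`, `actW`, `cW_pos`, `norm_actW_X₀_lt_one`, `exp_locE_cube`) are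
used BY NAME.

WHY.  Every Gaussian-core witness of the crew states the LIVENESS of its END's bounded quantity for a REAL source only (`actW_live` ∕
`actW_real_live` W33∕W37, `actM_mu_live` W35, `actD_mu_live` W41, `actT_mu_live` W47, `actF_mu_live`, `actI_mu_live`, `towerMuEnd_live`,
`rebornMuPart_live` W87: `0 < t`, positivity of `∫(e^{t·r·e^{−x²}} − 1)e^{−‖v‖²}`), whereas the μ-ENDs' (w6) windows are COMPLEX discs
`‖μ‖ ≤ μ₀`.  The missing piece is one [folklore] calculus lemma: the one-cube term `τ ↦ ∫ e^{τ·r·e^{−(v 0)²}}·e^{−‖v‖²} dv` is INJECTIVE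
— indeed two-sided Lipschitz about its linearisation — on the closed source disc `‖τ‖ ≤ ρ` as soon as `2ρr < 1`.

* §1 POINTWISE ([folklore], Mathlib's convex-set mean value inequality + `Complex.norm_exp_sub_one_le`): for `0 ≤ G ≤ r`, `‖τ‖, ‖τ′‖ ≤ ρ`,
  `ρ·r ≤ 1`: **`‖e^{τG} − e^{τ′G} − (τ − τ′)·G‖ ≤ 2ρ·r·G·‖τ − τ′‖`** (`norm_cexp_sub_cexp_sub_lin_le`);
* §2 INTEGRATED against the Gaussian weight: `pencil r τ := ∫ e^{τ·(r·e^{−(crd v)²})}·e^{−‖v‖²}`, `pencilM r := ∫ r·e^{−(crd v)²}·e^{−‖v‖²} > 0`;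
  **`norm_pencil_sub_sub_lin_le : ‖pencil r τ − pencil r τ′ − (τ − τ′)·pencilM r‖ ≤ 2ρr·pencilM r·‖τ − τ′‖`**, the SANDWICH
  `(1 − 2ρr)·pencilM r·‖τ − τ′‖ ≤ ‖pencil r τ − pencil r τ′‖ ≤ (1 + 2ρr)·pencilM r·‖τ − τ′‖` and **`pencil_injOn : 2ρr < 1 →
  InjOn (pencil r) (closedBall 0 ρ)`** (`pencil_eq_iff`; for consumers `pencil_ne_pencil_zero` ∕ `pencil_coLipschitz_zero` against the
  centre `τ′ = 0`) — THE COMPLEX SOURCE IS RECOVERABLE FROM THE ONE-CUBE TERM, with modulus;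
* §3 ON W33's DATUM BY NAME: `actW r hr N k s X₀ = cW r·pencil r s` (`termBi_coreFam`), **`actW_injOn`**, and **`coresEnd_live_complex`**:
  `E_{H_s}(X₀) ≠ E_{H_{s′}}(X₀)` for every two DISTINCT COMPLEX sources in `closedBall 0 ρ` (`2ρr < 1`, `ρ ≤ 1`; W24's `exp_locE_cube` + W33's
  `norm_actW_X₀_lt_one`); W33's `coresEnd_live` is the real pair `(1, 0)` (which needs no radius).
PART 2 (`…/DressedRebornMuPartSeparableWitnessComplex`): W87's re-born μ-part over ANY non-degenerate complex rectangle is live.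

LOCATED.  The radius `ρ < 1∕(2r)` is OURS and only SUFFICIENT: no injectivity is claimed (none holds) at source separations `‖τ − τ′‖·r` of
the order of `2π`, where `e^{τG}` repeats; the real-source liveness lemmas above need no radius and are NOT superseded.

HONEST FRAMING.  A DECIDED-TOY calculus lemma ([folklore]; 0 sorry; 0 citations) about OUR Gaussian cores on NE5's toy frame — the radius
`2ρr < 1` is OURS and only SUFFICIENT; a statement about the toy term, NOT about Bałaban's (2.14) densities; «identifiable ∕ injective» concerns
the toy's one-cube term as a function of the complex source; it exercises NO binder of N0p ∕ S56 beyond what W33 ∕ W87 already fire, and moves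
no wall; the μ-extension READING stays the cell's, UNPRINTED (C-t4r2-340 (n1)); (B1b) NOT claimed; (B3) = W33's `hL3_W` BY CHOICE (G-ne9p2-5
UNPRINTED); `pencil` ∕ `pencilM` are DATA `def`s (no `def … : Prop`); 0 binders instantiated on Bałaban's densities; no wall item; wall v1.8 (T4-DAG v48;
v49–v52 verbatim) — words, not kind — does NOT move; R-t4r2-Q2 NOT met; NE1′ ⇐ the named binders — NOT proved, NOT printed; spine PROVED 0∕9;
count 9 unchanged.  Rung (B)+1 on ONE finite four-torus — NOT infinite volume, NOT a mass gap, NOT OS on ℝ⁴, NOT Clay.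
HONEST DEPENDENCY: continuum YM on T⁴ ⇐ BetaPertH ∧ nine spine estimates (0/9 proved); BetaPertH ⇐ (D1) ∧ (D4) ∧ CAP+tail; G-an2-4
gates asym, D1 and NE2/3/4.
-/

noncomputable section

namespace Summit.QuantumFields.BalabanUV.T4Continuum.NE1p.DressedSmallFieldPencilInjective

open Set Metric MeasureTheory Complex
open scoped BigOperators
open Literature.MathematicalPhysics.QuantumFieldTheory.Balaban1983to89
open Literature.MathematicalPhysics.QuantumFieldTheory.Balaban1983to89.B13Resummation (locE)
open Literature.MathematicalPhysics.QuantumFieldTheory.Balaban1983to89.TreeLengthTorus (TDom tsys)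
open Literature.MathematicalPhysics.QuantumFieldTheory.Balaban1983to89.TreeLengthTorusGeometry (tgeometry TTouch)
open Summit.QuantumFields.BalabanUV.T4Continuum.NE1p.DressedSmallFieldTorusWitness (X₀ exp_locE_cube)
open Summit.QuantumFields.BalabanUV.T4Continuum.NE1p.DressedSmallFieldCoresWitness (E1 crd integrable_gauss_E1 integrable_gauss_E1_cexp
  integrable_term termBi_coreFam
  actW termsW_X₀ cW cW_pos norm_actW_X₀_lt_one)

/-! ## §1 POINTWISE: `e^{τG}` is within `2ρrG·‖τ − τ′‖` of its linearisation on the source disc `‖τ‖ ≤ ρ` (`0 ≤ G ≤ r`, `ρr ≤ 1`) -/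

/-- The derivative of `ζ ↦ e^{ζG} − ζG` is `G·e^{ζG} − G`. [folklore] -/
theorem hasDerivAt_cexp_mul_sub_lin (G : ℝ) (ζ : ℂ) :
    HasDerivAt (fun ζ : ℂ => cexp (ζ * G) - ζ * G) (cexp (ζ * G) * G - G) ζ := by
  have h1 : HasDerivAt (fun ζ : ℂ => ζ * (G : ℂ)) (G : ℂ) ζ := by
    simpa using (hasDerivAt_id ζ).mul_const (G : ℂ)
  exact (h1.cexp).sub h1

/-- On the disc the derivative above is SMALL: `‖G·e^{ζG} − G‖ ≤ 2ρ·r·G` for `‖ζ‖ ≤ ρ`, `0 ≤ G ≤ r`, `ρ·r ≤ 1`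
(`Complex.norm_exp_sub_one_le`: `‖e^z − 1‖ ≤ 2‖z‖` for `‖z‖ ≤ 1`, at `z = ζG` with `‖ζG‖ ≤ ρr ≤ 1`). [folklore] -/
theorem norm_deriv_cexp_mul_sub_lin_le {ρ r G : ℝ} (hG0 : 0 ≤ G) (hGr : G ≤ r) (hρ : 0 ≤ ρ) (hρr : ρ * r ≤ 1) {ζ : ℂ}
    (hζ : ‖ζ‖ ≤ ρ) : ‖cexp (ζ * G) * G - G‖ ≤ 2 * ρ * r * G := by
  have hz : ‖ζ * (G : ℂ)‖ ≤ ρ * G := by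
    rw [norm_mul, Complex.norm_real, Real.norm_eq_abs, abs_of_nonneg hG0]
    exact mul_le_mul_of_nonneg_right hζ hG0
  have hz1 : ‖ζ * (G : ℂ)‖ ≤ 1 := hz.trans ((mul_le_mul_of_nonneg_left hGr hρ).trans hρr)
  have hfac : cexp (ζ * G) * G - G = (cexp (ζ * G) - 1) * G := by ring
  rw [hfac, norm_mul, Complex.norm_real, Real.norm_eq_abs, abs_of_nonneg hG0]
  calc ‖cexp (ζ * G) - 1‖ * G ≤ 2 * ‖ζ * (G : ℂ)‖ * G :=
        mul_le_mul_of_nonneg_right (Complex.norm_exp_sub_one_le hz1) hG0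
    _ ≤ 2 * (ρ * G) * G := by gcongr
    _ ≤ 2 * (ρ * r) * G := by
        have : ρ * G ≤ ρ * r := mul_le_mul_of_nonneg_left hGr hρ
        nlinarith
    _ = 2 * ρ * r * G := by ring

/-- **§1 THE POINTWISE ESTIMATE**: for `0 ≤ G ≤ r`, `‖τ‖, ‖τ′‖ ≤ ρ` and `ρ·r ≤ 1`,
`‖e^{τG} − e^{τ′G} − (τ − τ′)·G‖ ≤ 2ρ·r·G·‖τ − τ′‖` — the convex-set mean value inequality
(`Convex.norm_image_sub_le_of_norm_hasDerivWithin_le` on `closedBall 0 ρ`) for `ζ ↦ e^{ζG} − ζG`. [folklore] -/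
theorem norm_cexp_sub_cexp_sub_lin_le {ρ r G : ℝ} (hG0 : 0 ≤ G) (hGr : G ≤ r) (hρ : 0 ≤ ρ) (hρr : ρ * r ≤ 1) {τ τ' : ℂ}
    (hτ : ‖τ‖ ≤ ρ) (hτ' : ‖τ'‖ ≤ ρ) :
    ‖cexp (τ * G) - cexp (τ' * G) - (τ - τ') * G‖ ≤ 2 * ρ * r * G * ‖τ - τ'‖ := by
  have hmv := Convex.norm_image_sub_le_of_norm_hasDerivWithin_le (f := fun ζ : ℂ => cexp (ζ * G) - ζ * G)
    (f' := fun ζ : ℂ => cexp (ζ * G) * G - G) (s := closedBall (0 : ℂ) ρ) (x := τ') (y := τ)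
    (fun ζ _ => (hasDerivAt_cexp_mul_sub_lin G ζ).hasDerivWithinAt)
    (fun ζ hζ => norm_deriv_cexp_mul_sub_lin_le hG0 hGr hρ hρr (mem_closedBall_zero_iff.1 hζ))
    (convex_closedBall _ _) (mem_closedBall_zero_iff.2 hτ') (mem_closedBall_zero_iff.2 hτ)
  have heq : cexp (τ * G) - τ * G - (cexp (τ' * G) - τ' * G) = cexp (τ * G) - cexp (τ' * G) - (τ - τ') * G := by ring
  rw [heq] at hmv
  exact hmv

/-! ## §2 THE PENCIL TERM AS A FUNCTION OF THE COMPLEX SOURCE: within `2ρr·pencilM·‖τ − τ′‖` of its linearisation, hence injective -/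

/-- THE ONE-CUBE GAUSSIAN-CORE PENCIL TERM read as a function of the complex source (toy DATA): `pencil r τ = ∫ e^{τ·(r·e^{−(crd v)²})}·e^{−‖v‖²} dv`
— VERBATIM the integral of W33's `termBi_coreFam`. [folklore] -/
def pencil (r : ℝ) (τ : ℂ) : ℂ := ∫ v : E1, cexp (τ * ((r : ℂ) * (Real.exp (-(crd v ^ 2)) : ℂ))) * cexp (-(((‖v‖ ^ 2 : ℝ) : ℂ)))

/-- Its FIRST MOMENT (the source derivative at `τ = 0`; toy DATA): `pencilM r = ∫ r·e^{−(crd v)²}·e^{−‖v‖²} dv`. [folklore] -/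
def pencilM (r : ℝ) : ℝ := ∫ v : E1, r * Real.exp (-(crd v ^ 2)) * Real.exp (-‖v‖ ^ 2)

variable (r : ℝ) (hr : 0 ≤ r)

include hr in
/-- The read-out letter `G(v) = r·e^{−(crd v)²}` lies in `[0, r]` for `0 ≤ r`. [folklore] -/
theorem readOut_mem (v : E1) : 0 ≤ r * Real.exp (-(crd v ^ 2)) ∧ r * Real.exp (-(crd v ^ 2)) ≤ r := by
  refine ⟨mul_nonneg hr (Real.exp_pos _).le, ?_⟩
  calc r * Real.exp (-(crd v ^ 2)) ≤ r * 1 := by gcongr; exact Real.exp_le_one_iff.2 (neg_nonpos.2 (sq_nonneg _))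
    _ = r := mul_one r

include hr in
/-- The first-moment integrand is integrable (continuous, dominated by `r·e^{−‖v‖²}`). [folklore] -/
theorem integrable_moment : Integrable (fun v : E1 => r * Real.exp (-(crd v ^ 2)) * Real.exp (-‖v‖ ^ 2)) := by
  have hc : Continuous (fun v : E1 => r * Real.exp (-(crd v ^ 2)) * Real.exp (-‖v‖ ^ 2)) := by unfold crd; fun_prop
  refine Integrable.mono' ((integrable_gauss_E1).const_mul r) hc.aestronglyMeasurable (Filter.Eventually.of_forall fun v => ?_)
  rw [Real.norm_eq_abs, abs_of_nonneg (mul_nonneg (readOut_mem r hr v).1 (Real.exp_pos _).le)]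
  exact mul_le_mul_of_nonneg_right (readOut_mem r hr v).2 (Real.exp_pos _).le

/-- **`0 < pencilM r`** for `0 < r`: the integrand is everywhere positive and the inner-product Lebesgue measure charges open sets. [folklore] -/
theorem pencilM_pos (hr0 : 0 < r) : 0 < pencilM r := by
  have hpos : ∀ v : E1, 0 < r * Real.exp (-(crd v ^ 2)) * Real.exp (-‖v‖ ^ 2) := fun v =>
    mul_pos (mul_pos hr0 (Real.exp_pos _)) (Real.exp_pos _)
  have hsupp : Function.support (fun v : E1 => r * Real.exp (-(crd v ^ 2)) * Real.exp (-‖v‖ ^ 2)) = Set.univ :=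
    Set.eq_univ_of_forall fun v => (hpos v).ne'
  unfold pencilM
  rw [integral_pos_iff_support_of_nonneg_ae (Filter.Eventually.of_forall fun v => (hpos v).le) (integrable_moment r hr0.le), hsupp]
  exact isOpen_univ.measure_pos volume Set.univ_nonempty

include hr in
/-- `pencilM r ≤ r·√π` (`G ≤ r`, W33's `gaussian_E1`). [folklore] -/
theorem pencilM_le : pencilM r ≤ r * Real.sqrt Real.pi := by
  unfold pencilM
  rw [← DressedSmallFieldCoresWitness.gaussian_E1, ← integral_const_mul]
  exact integral_mono (integrable_moment r hr) ((integrable_gauss_E1).const_mul r)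
    fun v => mul_le_mul_of_nonneg_right (readOut_mem r hr v).2 (Real.exp_pos _).le

include hr in
/-- The linear term's integrand is integrable (a bounded continuous factor `‖c·G‖ ≤ ‖c‖·r` times W33's complex Gaussian). [folklore] -/
theorem integrable_lin (c : ℂ) :
    Integrable (fun v : E1 => c * ((r : ℂ) * (Real.exp (-(crd v ^ 2)) : ℂ)) * cexp (-(((‖v‖ ^ 2 : ℝ) : ℂ)))) := by
  have hc : Continuous fun v : E1 => c * ((r : ℂ) * (Real.exp (-(crd v ^ 2)) : ℂ)) := by unfold crd; fun_prop
  have hb : ∀ v : E1, ‖c * ((r : ℂ) * (Real.exp (-(crd v ^ 2)) : ℂ))‖ ≤ ‖c‖ * r := fun v => by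
    have hG := readOut_mem r hr v
    have hcast : ((r : ℂ) * (Real.exp (-(crd v ^ 2)) : ℂ)) = ((r * Real.exp (-(crd v ^ 2)) : ℝ) : ℂ) := by push_cast; ring
    rw [norm_mul, hcast, Complex.norm_real, Real.norm_eq_abs, abs_of_nonneg hG.1]
    exact mul_le_mul_of_nonneg_left hG.2 (norm_nonneg c)
  exact (integrable_gauss_E1_cexp).bdd_mul hc.aestronglyMeasurable (Filter.Eventually.of_forall hb)

/-- The linear term integrates to `c·pencilM r`. [folklore] -/
theorem integral_lin (c : ℂ) :
    ∫ v : E1, c * ((r : ℂ) * (Real.exp (-(crd v ^ 2)) : ℂ)) * cexp (-(((‖v‖ ^ 2 : ℝ) : ℂ))) = c * (pencilM r : ℂ) := by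
  unfold pencilM
  rw [← integral_complex_ofReal, ← integral_const_mul]
  refine integral_congr_ae (Filter.Eventually.of_forall fun v => ?_)
  dsimp only
  push_cast; ring

include hr in
/-- §1 under the Gaussian weight, pointwise in the fluctuation variable. [folklore] -/
theorem norm_integrand_le {ρ : ℝ} (hρ : 0 ≤ ρ) (hρr : ρ * r ≤ 1) {τ τ' : ℂ} (hτ : ‖τ‖ ≤ ρ) (hτ' : ‖τ'‖ ≤ ρ) (v : E1) :
    ‖(cexp (τ * ((r : ℂ) * (Real.exp (-(crd v ^ 2)) : ℂ))) - cexp (τ' * ((r : ℂ) * (Real.exp (-(crd v ^ 2)) : ℂ))) -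
        (τ - τ') * ((r : ℂ) * (Real.exp (-(crd v ^ 2)) : ℂ))) * cexp (-(((‖v‖ ^ 2 : ℝ) : ℂ)))‖ ≤
      2 * ρ * r * ‖τ - τ'‖ * (r * Real.exp (-(crd v ^ 2)) * Real.exp (-‖v‖ ^ 2)) := by
  have hG := readOut_mem r hr v
  have h1 := norm_cexp_sub_cexp_sub_lin_le hG.1 hG.2 hρ hρr hτ hτ'
  have hcast : ((r : ℂ) * (Real.exp (-(crd v ^ 2)) : ℂ)) = ((r * Real.exp (-(crd v ^ 2)) : ℝ) : ℂ) := by push_cast; ring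
  rw [hcast, norm_mul, ← Complex.ofReal_neg, Complex.norm_exp_ofReal]
  calc _ ≤ 2 * ρ * r * (r * Real.exp (-(crd v ^ 2))) * ‖τ - τ'‖ * Real.exp (-‖v‖ ^ 2) :=
        mul_le_mul_of_nonneg_right h1 (Real.exp_pos _).le
    _ = _ := by ring

include hr in
/-- **§2 THE PENCIL TERM IS WITHIN `2ρr·pencilM·‖τ − τ′‖` OF ITS LINEARISATION** on the disc `‖τ‖, ‖τ′‖ ≤ ρ`, `ρr ≤ 1`:
`‖pencil r τ − pencil r τ′ − (τ − τ′)·pencilM r‖ ≤ 2ρr·pencilM r·‖τ − τ′‖` (§1 under the integral, `norm_integral_le_of_norm_le`). [folklore] -/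
theorem norm_pencil_sub_sub_lin_le {ρ : ℝ} (hρ : 0 ≤ ρ) (hρr : ρ * r ≤ 1) {τ τ' : ℂ} (hτ : ‖τ‖ ≤ ρ) (hτ' : ‖τ'‖ ≤ ρ) :
    ‖pencil r τ - pencil r τ' - (τ - τ') * (pencilM r : ℂ)‖ ≤ 2 * ρ * r * pencilM r * ‖τ - τ'‖ := by
  have hsub : pencil r τ - pencil r τ' - (τ - τ') * (pencilM r : ℂ) =
      ∫ v : E1, (cexp (τ * ((r : ℂ) * (Real.exp (-(crd v ^ 2)) : ℂ))) - cexp (τ' * ((r : ℂ) * (Real.exp (-(crd v ^ 2)) : ℂ))) -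
        (τ - τ') * ((r : ℂ) * (Real.exp (-(crd v ^ 2)) : ℂ))) * cexp (-(((‖v‖ ^ 2 : ℝ) : ℂ))) := by
    unfold pencil
    rw [← integral_lin r (τ - τ'), ← integral_sub (integrable_term r hr τ) (integrable_term r hr τ'), ← integral_sub]
    · exact integral_congr_ae (Filter.Eventually.of_forall fun v => by ring)
    · exact (integrable_term r hr τ).sub (integrable_term r hr τ')
    · exact integrable_lin r hr (τ - τ')
  rw [hsub]
  have hI := norm_integral_le_of_norm_le ((integrable_moment r hr).const_mul (2 * ρ * r * ‖τ - τ'‖))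
    (Filter.Eventually.of_forall (norm_integrand_le r hr hρ hρr hτ hτ'))
  rw [integral_const_mul] at hI
  calc _ ≤ 2 * ρ * r * ‖τ - τ'‖ * pencilM r := hI
    _ = 2 * ρ * r * pencilM r * ‖τ - τ'‖ := by ring

include hr in
/-- `0 ≤ pencilM r`. [folklore] -/
theorem pencilM_nonneg : 0 ≤ pencilM r := by
  unfold pencilM; exact integral_nonneg fun v => mul_nonneg (readOut_mem r hr v).1 (Real.exp_pos _).le

include hr in
/-- The linear term's size: `‖(τ − τ′)·pencilM r‖ = pencilM r·‖τ − τ′‖`. [folklore] -/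
theorem norm_lin (τ τ' : ℂ) : ‖(τ - τ') * (pencilM r : ℂ)‖ = pencilM r * ‖τ - τ'‖ := by
  rw [norm_mul, Complex.norm_real, Real.norm_eq_abs, abs_of_nonneg (pencilM_nonneg r hr), mul_comm]

include hr in
/-- **THE LOWER (CO-LIPSCHITZ) HALF OF THE SANDWICH**: `(1 − 2ρr)·pencilM r·‖τ − τ′‖ ≤ ‖pencil r τ − pencil r τ′‖`. [folklore] -/
theorem pencil_coLipschitz {ρ : ℝ} (hρ : 0 ≤ ρ) (hρr : ρ * r ≤ 1) {τ τ' : ℂ} (hτ : ‖τ‖ ≤ ρ) (hτ' : ‖τ'‖ ≤ ρ) :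
    (1 - 2 * ρ * r) * pencilM r * ‖τ - τ'‖ ≤ ‖pencil r τ - pencil r τ'‖ := by
  have h := norm_pencil_sub_sub_lin_le r hr hρ hρr hτ hτ'
  have hlin := norm_lin r hr τ τ'
  have htri : ‖(τ - τ') * (pencilM r : ℂ)‖ - ‖pencil r τ - pencil r τ'‖ ≤
      ‖pencil r τ - pencil r τ' - (τ - τ') * (pencilM r : ℂ)‖ := by
    have := norm_sub_norm_le ((τ - τ') * (pencilM r : ℂ)) (pencil r τ - pencil r τ')
    rwa [norm_sub_rev ((τ - τ') * (pencilM r : ℂ)) (pencil r τ - pencil r τ')] at this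
  nlinarith [hlin, htri, h]

include hr in
/-- THE UPPER (LIPSCHITZ) HALF: `‖pencil r τ − pencil r τ′‖ ≤ (1 + 2ρr)·pencilM r·‖τ − τ′‖`. [folklore] -/
theorem pencil_lipschitz {ρ : ℝ} (hρ : 0 ≤ ρ) (hρr : ρ * r ≤ 1) {τ τ' : ℂ} (hτ : ‖τ‖ ≤ ρ) (hτ' : ‖τ'‖ ≤ ρ) :
    ‖pencil r τ - pencil r τ'‖ ≤ (1 + 2 * ρ * r) * pencilM r * ‖τ - τ'‖ := by
  have h := norm_pencil_sub_sub_lin_le r hr hρ hρr hτ hτ'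
  have hlin := norm_lin r hr τ τ'
  have htri : ‖pencil r τ - pencil r τ'‖ ≤ ‖pencil r τ - pencil r τ' - (τ - τ') * (pencilM r : ℂ)‖ + ‖(τ - τ') * (pencilM r : ℂ)‖ :=
    norm_le_norm_sub_add _ _
  nlinarith [hlin, htri, h]

/-- **§2 THE PENCIL TERM IS INJECTIVE ON THE SOURCE DISC `‖τ‖ ≤ ρ` WHENEVER `2ρr < 1`** (`0 < r`): THE COMPLEX SOURCE IS RECOVERABLE FROM THE
ONE-CUBE TERM. [folklore] -/
theorem pencil_injOn (hr0 : 0 < r) {ρ : ℝ} (hρ : 0 ≤ ρ) (h2 : 2 * ρ * r < 1) : InjOn (pencil r) (closedBall (0 : ℂ) ρ) := by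
  intro τ hτ τ' hτ' heq
  have hρr : ρ * r ≤ 1 := by nlinarith [mul_nonneg hρ hr0.le]
  have h := pencil_coLipschitz r hr0.le hρ hρr (mem_closedBall_zero_iff.1 hτ) (mem_closedBall_zero_iff.1 hτ')
  rw [heq, sub_self, norm_zero] at h
  have hc : 0 < (1 - 2 * ρ * r) * pencilM r := mul_pos (by linarith) (pencilM_pos r hr0)
  have hn : ‖τ - τ'‖ ≤ 0 := by
    by_contra hlt
    exact absurd h (not_le.2 (mul_pos hc (not_le.1 hlt)))
  exact sub_eq_zero.1 (norm_le_zero_iff.1 hn)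

/-- … in `↔` form: on the disc, `pencil r τ = pencil r τ′ ↔ τ = τ′`. [folklore] -/
theorem pencil_eq_iff (hr0 : 0 < r) {ρ : ℝ} (hρ : 0 ≤ ρ) (h2 : 2 * ρ * r < 1) {τ τ' : ℂ} (hτ : ‖τ‖ ≤ ρ) (hτ' : ‖τ'‖ ≤ ρ) :
    pencil r τ = pencil r τ' ↔ τ = τ' :=
  ⟨fun h => pencil_injOn r hr0 hρ h2 (mem_closedBall_zero_iff.2 hτ) (mem_closedBall_zero_iff.2 hτ') h, fun h => by rw [h]⟩

/-- **LIVENESS AT THE CENTRE, FOR CONSUMERS** (W85∕W94∕W97-type μ-witnesses): `pencil r τ ≠ pencil r 0` for every complex source `τ ≠ 0` with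
`‖τ‖ ≤ ρ`, `2ρr < 1` (`0 < r`) — one line from `pencil_eq_iff` at `τ′ = 0`. [folklore] -/
theorem pencil_ne_pencil_zero (hr0 : 0 < r) {ρ : ℝ} (h2 : 2 * ρ * r < 1) {τ : ℂ} (hτ : ‖τ‖ ≤ ρ) (hne : τ ≠ 0) :
    pencil r τ ≠ pencil r 0 := fun h =>
  hne ((pencil_eq_iff r hr0 ((norm_nonneg τ).trans hτ) h2 hτ (by rw [norm_zero]; exact (norm_nonneg τ).trans hτ)).1 h)

include hr in
/-- … with the co-Lipschitz MODULUS: `(1 − 2ρr)·pencilM r·‖τ‖ ≤ ‖pencil r τ − pencil r 0‖` (`0 ≤ r`, `ρr ≤ 1`). [folklore] -/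
theorem pencil_coLipschitz_zero {ρ : ℝ} (hρr : ρ * r ≤ 1) {τ : ℂ} (hτ : ‖τ‖ ≤ ρ) :
    (1 - 2 * ρ * r) * pencilM r * ‖τ‖ ≤ ‖pencil r τ - pencil r 0‖ := by
  have h := pencil_coLipschitz r hr ((norm_nonneg τ).trans hτ) hρr hτ (by rw [norm_zero]; exact (norm_nonneg τ).trans hτ)
  rwa [sub_zero] at h

/-! ## §3 ON W33's DATUM BY NAME: the activity at `X₀` IS `cW r·pencil r s`; complex-source liveness of N0p's cores END -/

section Torus
variable (N : ℕ) [NeZero N]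

/-- W33's activity at the cube READ THROUGH the pencil term: `actW r hr N k s X₀ = cW r·pencil r s` (W33's `termBi_coreFam` BY NAME). [folklore] -/
theorem actW_X₀_eq_pencil (k : ℕ) (s : ℂ) : actW r hr N k s (X₀ N) = (cW r : ℂ) * pencil r s := by
  unfold actW
  rw [termsW_X₀, Finset.sum_singleton, termBi_coreFam]
  rfl

/-- **W33's ACTIVITY AT `X₀` IS INJECTIVE IN THE COMPLEX SOURCE** on `closedBall 0 ρ`, `2ρr < 1` (`cW r ≠ 0`, §2). [folklore] -/
theorem actW_injOn (hr0 : 0 < r) (k : ℕ) {ρ : ℝ} (hρ : 0 ≤ ρ) (h2 : 2 * ρ * r < 1) :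
    InjOn (fun s : ℂ => actW r hr N k s (X₀ N)) (closedBall (0 : ℂ) ρ) := by
  intro s hs s' hs' heq
  have h : (cW r : ℂ) * pencil r s = (cW r : ℂ) * pencil r s' := by
    have := heq; simp only [actW_X₀_eq_pencil] at this; exact this
  have hc : (cW r : ℂ) ≠ 0 := by exact_mod_cast (cW_pos r).ne'
  exact pencil_injOn r hr0 hρ h2 hs hs' (mul_left_cancel₀ hc h)

open Classical in
/-- **COMPLEX-SOURCE LIVENESS OF THE CORES END's BOUNDED QUANTITY** [decided toy]: for every two DISTINCT COMPLEX sources `s ≠ s′` with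
`‖s‖, ‖s′‖ ≤ ρ ≤ 1` and `2ρr < 1`, the dressed small-field outputs at `X₀` DIFFER — W24's `exp_locE_cube` (`exp E_w({0}) = 1 + w X₀` for
`‖w X₀‖ < 1`, W33's `norm_actW_X₀_lt_one`) turns equal outputs into equal activities, and §3's `actW_injOn` forbids that.  W33's `coresEnd_live`
is the real pair `(s, s′) = (1, 0)`, radius-free. [folklore] -/
theorem coresEnd_live_complex (hr0 : 0 < r) (k : ℕ) {ρ : ℝ} (hρ1 : ρ ≤ 1) (h2 : 2 * ρ * r < 1) {s s' : ℂ} (hs : ‖s‖ ≤ ρ)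
    (hs' : ‖s'‖ ≤ ρ) (hne : s ≠ s') :
    locE (tgeometry 4 N).ι (tgeometry 4 N).cubes (actW r hr N k s) ((tgeometry 4 N).cubes (X₀ N)) ≠
      locE (tgeometry 4 N).ι (tgeometry 4 N).cubes (actW r hr N k s') ((tgeometry 4 N).cubes (X₀ N)) := by
  intro h
  have h1 := exp_locE_cube N (w := actW r hr N k s) (norm_actW_X₀_lt_one r hr N hr0 k (hs.trans hρ1))
  have h0 := exp_locE_cube N (w := actW r hr N k s') (norm_actW_X₀_lt_one r hr N hr0 k (hs'.trans hρ1))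
  have h' : cexp (locE (TTouch (d := 4) (N := N)) (fun Z : (tsys 4 N).Dom => Z.1) (actW r hr N k s) {0}) =
      cexp (locE (TTouch (d := 4) (N := N)) (fun Z : (tsys 4 N).Dom => Z.1) (actW r hr N k s') {0}) := congrArg cexp h
  rw [h1, h0, add_right_inj] at h'
  exact hne (actW_injOn r hr N hr0 k ((norm_nonneg s).trans hs) h2 (mem_closedBall_zero_iff.2 hs) (mem_closedBall_zero_iff.2 hs') h')

open Classical in
/-- **… in `↔` form**: on the disc, `E_{H_s}(X₀) = E_{H_{s′}}(X₀) ↔ s = s′` — the cores END's output DETERMINES the complex source. [folklore] -/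
theorem coresEnd_eq_iff (hr0 : 0 < r) (k : ℕ) {ρ : ℝ} (hρ1 : ρ ≤ 1) (h2 : 2 * ρ * r < 1) {s s' : ℂ} (hs : ‖s‖ ≤ ρ) (hs' : ‖s'‖ ≤ ρ) :
    locE (tgeometry 4 N).ι (tgeometry 4 N).cubes (actW r hr N k s) ((tgeometry 4 N).cubes (X₀ N)) =
        locE (tgeometry 4 N).ι (tgeometry 4 N).cubes (actW r hr N k s') ((tgeometry 4 N).cubes (X₀ N)) ↔ s = s' :=
  ⟨fun h => by_contra fun hne => coresEnd_live_complex r hr N hr0 k hρ1 h2 hs hs' hne h, fun h => by rw [h]⟩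

/-- THE RADIUS IS A GENUINE HYPOTHESIS OF THE METHOD, NOT OF W33's REAL PAIR: at `r = 1` the disc `2ρr < 1` stops at `ρ < ½` and does not
contain the real source `1` of W33's `coresEnd_live` — the complex lemma does not supersede the real one. [folklore] -/
example : ¬ (2 * (1 : ℝ) * 1 < 1) := by norm_num

end Torus

end Summit.QuantumFields.BalabanUV.T4Continuum.NE1p.DressedSmallFieldPencilInjective

end
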